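import Literature.MathematicalPhysics.QuantumLattice.HubbardBondAlgebra
import Literature.Analysis.Complex.IteratedDifferenceBound
import Literature.Probability.LatticeModels.PolymerPushforward
import HarnessLib

/-!
# The polymer representation of the Hubbard partition function around the atomic limit

Ueltschi (1999), proof of Theorem 2.1 (i) (§2.3) specialised to the Hubbard model (§3): the
grand-canonical partition function on a finite volume `Λ` with free boundary conditions is
`z₀^{|Λ|}` times the partition function of a hard-core gas of SUBSET polymers `A ⊆ Λ`
(incompatible iff intersecting), `Tr e^{-β(H - μN)} = z₀^{|Λ|} Ξ(ρ)` — Ueltschi's eq. for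
`Tr e^{-βH_Λ}` after "we call `𝒜₁,…,𝒜_ℓ` polymers and define their weight `ρ(𝒜)`".

Ueltschi defines `ρ(𝒜)` through the Duhamel expansion; here the SAME regrouping is carried out on
the level of bond sets by inclusion–exclusion, which avoids time-ordered integrals: with the
normalised Gibbs factor `g(c) = Zc(c)/Zc(0)` of arbitrary complex bond couplings
(`HubbardBondAlgebra.Zc`, `gibbsRatio`),

* the **bond weight** `M(K) = Σ_{K' ⊆ K} (-1)^{|K∖K'|} g(τ 1_{K'})` of a finite set of bonds `K`
  (`bondWeight`; the iterated finite difference `iterDiff τ K g 0` of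
  `IteratedDifferenceBound`), which is MULTIPLICATIVE over bond sets with disjoint supports
  (`bondWeight_union`, from the factorisation property `Zc_add_mul_Zc_zero`);
* Möbius inversion `g(τ 1_D) = Σ_{K ⊆ D} M(K)` over the bonds `D` of the graph, the component
  decomposition and the pushforward along the support map (`PolymerPushforward`) give the
  **polymer representation** (`Zc_hubbardCoupling_eq_mul_polymerPartitionFunction`,
  `partitionFn_eq_mul_polymerPartitionFunction`):
  `Z_Λ = z₀^{|Λ|} · Ξ^{polyInc}_{𝒫(Λ)}(siteActivity)`, with the **site activity**
  `siteActivity A = Σ_{X ⊆ D connected, supp X = A} M(X)`;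
* the site activity lives on `G`-connected sets (`isRConnected_of_siteActivity_ne_zero`) and is
  **covariant under embeddings** of induced subgraphs along order embeddings of the sites
  (`siteActivity_map`, from the volume independence `Zc_extend`) — this yields both translation
  invariance and independence of the enclosing box for the weights on `ℤ^d`.

All statements require `z₀(β, U, μ) ≠ 0` where a normalisation by `Zc(0) = z₀^{|Λ|}` occurs
(automatic for real parameters). Everything is PROVED.

## Mathlib / tree search

Tree: `Zc`, `Zc_zero`, `Zc_add_mul_Zc_zero`, `Zc_extend`, `hubbardCoupling`,
`partitionFn_hamiltonianWith_eq_Zc` (`HubbardBondAlgebra`); `iterDiff` (`IteratedDifferenceBound`);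
`pushforwardActivity`, `connectedCellSets`, `sum_powerset_eq_polymerPartitionFunction_cellSupp`,
`pushforwardActivity_connectedCellSets_map`, `polymerPartitionFunction_eq_of_subset_of_eq_zero`
(`PolymerPushforward`); `sum_powerset_sum_powerset_neg_one_pow_card_sdiff_mul` (Möbius inversion,
`ClusterExpansion`); `sum_powerset_union_eq_sum_sum` (`FermionTraceFactorization`); `polyInc`.

## References

* D. Ueltschi, J. Stat. Phys. 95 (1999) 693, §2.3 (polymers, weights `ρ(𝒜)`, the polymer form of
  `Tr e^{-βH_Λ}`), §3 (Hubbard model: bonds `(⟨x,y⟩,σ)`, "polymers are connected sets").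
  [Ueltschi1999]
-/

noncomputable section

namespace Literature.MathematicalPhysics.QuantumLattice

open Matrix Finset HubbardWave0 Literature.Analysis.Complex.FiniteDifference Literature.Probability.LatticeModels
open scoped BigOperators

/-! ### The normalised Gibbs factor and the bond weights -/

section Weights

variable {Λ : Type*} [LinearOrder Λ] [Fintype Λ]

/-- The normalised Gibbs factor `g(c) = Zc(c)/Zc(0)` as a function of the complex bond couplings.
[cite: Ueltschi1999, §2.3 (the factor e^{βf₀|𝒜|} in the definition of ρ(𝒜))] -/
def gibbsRatio (β U μ : ℂ) (c : Bond Λ → ℂ) : ℂ := Zc β U μ c / Zc β U μ (0 : Bond Λ → ℂ)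

/-- The couplings `τ` on the bonds of `K` and `0` elsewhere: `τ 1_K`. [folklore] -/
def couplingOn (τ : ℂ) (K : Finset (Bond Λ)) : Bond Λ → ℂ := τ • Set.indicator (↑K : Set (Bond Λ)) 1

omit [Fintype Λ] in
/-- `τ 1_K` in coordinates. [folklore] -/
theorem couplingOn_apply (τ : ℂ) (K : Finset (Bond Λ)) (b : Bond Λ) :
    couplingOn τ K b = if b ∈ K then τ else 0 := by
  rw [couplingOn, Pi.smul_apply, indicator_coe_apply, smul_eq_mul, mul_ite, mul_one, mul_zero]

omit [Fintype Λ] in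
/-- `τ 1_K` is supported on `K`. [folklore] -/
theorem mem_of_couplingOn_ne_zero {τ : ℂ} {K : Finset (Bond Λ)} {b : Bond Λ} (h : couplingOn τ K b ≠ 0) : b ∈ K := by
  rw [couplingOn_apply] at h
  by_contra hb
  exact h (if_neg hb)

/-- **The bond weight** `M(K) = Σ_{K' ⊆ K} (-1)^{|K ∖ K'|} g(τ 1_{K'})`: the iterated finite
difference of the normalised Gibbs factor in the couplings of `K` (the inclusion–exclusion
analogue of Ueltschi's connected Duhamel terms). [cite: Ueltschi1999, §2.3 (definition of the polymer weights ρ(𝒜))] -/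
def bondWeight (β U μ τ : ℂ) (K : Finset (Bond Λ)) : ℂ := iterDiff τ K (gibbsRatio β U μ) 0

/-- `M(K)` as an explicit inclusion–exclusion sum. [folklore] -/
theorem bondWeight_eq_sum (β U μ τ : ℂ) (K : Finset (Bond Λ)) :
    bondWeight β U μ τ K = ∑ K' ∈ K.powerset, (-1) ^ (K \ K').card * gibbsRatio β U μ (couplingOn τ K') := by
  unfold bondWeight iterDiff couplingOn
  simp only [zero_add]

variable {β U μ : ℂ}

/-- `Zc(0) = z₀^{|Λ|} ≠ 0` when `z₀ ≠ 0`. [folklore] -/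
theorem Zc_zero_ne_zero (hz : atomicPartitionFn β U μ ≠ 0) : Zc β U μ (0 : Bond Λ → ℂ) ≠ 0 := by
  rw [Zc_zero]; exact pow_ne_zero _ hz

/-- `g(0) = 1`. [folklore] -/
theorem gibbsRatio_zero (hz : atomicPartitionFn β U μ ≠ 0) : gibbsRatio β U μ (0 : Bond Λ → ℂ) = 1 :=
  div_self (Zc_zero_ne_zero hz)

/-- `M(∅) = 1`. [folklore] -/
theorem bondWeight_empty (hz : atomicPartitionFn β U μ ≠ 0) (τ : ℂ) : bondWeight β U μ τ (∅ : Finset (Bond Λ)) = 1 := by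
  rw [bondWeight, iterDiff_empty, gibbsRatio_zero hz]

/-- **Multiplicativity of the normalised Gibbs factor** over couplings with disjoint supports
(from `Zc_add_mul_Zc_zero`). [cite: Ueltschi1999, §2.1 (factorization property)] -/
theorem gibbsRatio_add (hz : atomicPartitionFn β U μ ≠ 0) {A₁ A₂ : Finset Λ} (hA : Disjoint A₁ A₂)
    {c₁ c₂ : Bond Λ → ℂ} (hc₁ : ∀ b, c₁ b ≠ 0 → b.1 ∈ A₁ ∧ b.2.1 ∈ A₁) (hc₂ : ∀ b, c₂ b ≠ 0 → b.1 ∈ A₂ ∧ b.2.1 ∈ A₂) :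
    gibbsRatio β U μ (c₁ + c₂) = gibbsRatio β U μ c₁ * gibbsRatio β U μ c₂ := by
  have h := Zc_add_mul_Zc_zero β U μ hA hc₁ hc₂
  have h0 : Zc β U μ (0 : Bond Λ → ℂ) ≠ 0 := Zc_zero_ne_zero hz
  unfold gibbsRatio
  rw [div_mul_div_comm, eq_div_iff (mul_ne_zero h0 h0), div_mul_eq_mul_div, div_eq_iff h0]
  linear_combination Zc β U μ (0 : Bond Λ → ℂ) * h

/-! ### Supports of bond sets -/

omit [Fintype Λ] in
/-- Every bond has a nonempty (one- or two-element) vertex set. [folklore] -/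
theorem verts_nonempty (b : Bond Λ) : (Bond.verts b).Nonempty := by
  simp [Bond.verts]

omit [Fintype Λ] in
/-- The endpoints of a bond of `K` lie in the support of `K`. [folklore] -/
theorem endpoints_mem_cellSupp {K : Finset (Bond Λ)} {b : Bond Λ} (hb : b ∈ K) :
    b.1 ∈ cellSupp Bond.verts K ∧ b.2.1 ∈ cellSupp Bond.verts K :=
  ⟨mem_cellSupp.2 ⟨b, hb, Finset.mem_insert_self _ _⟩,
    mem_cellSupp.2 ⟨b, hb, Finset.mem_insert_of_mem (Finset.mem_singleton_self _)⟩⟩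

omit [Fintype Λ] in
/-- Bond sets with disjoint supports are disjoint. [folklore] -/
theorem disjoint_of_disjoint_cellSupp {K₁ K₂ : Finset (Bond Λ)}
    (h : Disjoint (cellSupp Bond.verts K₁) (cellSupp Bond.verts K₂)) : Disjoint K₁ K₂ :=
  Finset.disjoint_left.2 fun _ hb₁ hb₂ =>
    Finset.disjoint_left.1 h (endpoints_mem_cellSupp hb₁).1 (endpoints_mem_cellSupp hb₂).1

omit [Fintype Λ] in
/-- `τ 1_{K₁ ∪ K₂} = τ 1_{K₁} + τ 1_{K₂}` for disjoint bond sets. [folklore] -/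
theorem couplingOn_union (τ : ℂ) {K₁ K₂ : Finset (Bond Λ)} (h : Disjoint K₁ K₂) :
    couplingOn τ (K₁ ∪ K₂) = couplingOn τ K₁ + couplingOn τ K₂ := by
  funext b
  simp only [Pi.add_apply, couplingOn_apply, Finset.mem_union]
  by_cases h1 : b ∈ K₁
  · have h2 : b ∉ K₂ := Finset.disjoint_left.1 h h1
    simp [h1, h2]
  · by_cases h2 : b ∈ K₂ <;> simp [h1, h2]

omit [Fintype Λ] in
/-- Set algebra of inclusion–exclusion over a disjoint union. [folklore] -/
theorem union_sdiff_union_eq {K₁ K₂ K₁' K₂' : Finset (Bond Λ)} (h : Disjoint K₁ K₂) (h₁ : K₁' ⊆ K₁) (h₂ : K₂' ⊆ K₂) :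
    (K₁ ∪ K₂) \ (K₁' ∪ K₂') = (K₁ \ K₁') ∪ (K₂ \ K₂') := by
  ext b
  simp only [Finset.mem_sdiff, Finset.mem_union, not_or]
  constructor
  · rintro ⟨hb | hb, hn₁, hn₂⟩
    · exact Or.inl ⟨hb, hn₁⟩
    · exact Or.inr ⟨hb, hn₂⟩
  · rintro (⟨hb, hn⟩ | ⟨hb, hn⟩)
    · exact ⟨Or.inl hb, hn, fun h' => Finset.disjoint_left.1 h hb (h₂ h')⟩
    · exact ⟨Or.inr hb, fun h' => Finset.disjoint_left.1 h (h₁ h') hb, hn⟩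

/-- **Multiplicativity of the bond weights**: `M(K₁ ∪ K₂) = M(K₁) M(K₂)` whenever the supports of
`K₁`, `K₂` are disjoint (inclusion–exclusion of a multiplicative function).
[cite: Ueltschi1999, §2.3 (ρ factorises over components; polymers are the connected components)] -/
theorem bondWeight_union (hz : atomicPartitionFn β U μ ≠ 0) (τ : ℂ) {K₁ K₂ : Finset (Bond Λ)}
    (h : Disjoint (cellSupp Bond.verts K₁) (cellSupp Bond.verts K₂)) :
    bondWeight β U μ τ (K₁ ∪ K₂) = bondWeight β U μ τ K₁ * bondWeight β U μ τ K₂ := by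
  have hK : Disjoint K₁ K₂ := disjoint_of_disjoint_cellSupp h
  rw [bondWeight_eq_sum, bondWeight_eq_sum, bondWeight_eq_sum, sum_powerset_union_eq_sum_sum hK, Finset.sum_mul_sum]
  refine Finset.sum_congr rfl fun K₁' h₁ => Finset.sum_congr rfl fun K₂' h₂ => ?_
  have h₁' : K₁' ⊆ K₁ := Finset.mem_powerset.1 h₁
  have h₂' : K₂' ⊆ K₂ := Finset.mem_powerset.1 h₂
  have hK' : Disjoint K₁' K₂' := Finset.disjoint_of_subset_left h₁' (Finset.disjoint_of_subset_right h₂' hK)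
  have hsd : Disjoint (K₁ \ K₁') (K₂ \ K₂') :=
    Finset.disjoint_of_subset_left Finset.sdiff_subset (Finset.disjoint_of_subset_right Finset.sdiff_subset hK)
  have hc₁ : ∀ b, couplingOn τ K₁' b ≠ 0 → b.1 ∈ cellSupp Bond.verts K₁ ∧ b.2.1 ∈ cellSupp Bond.verts K₁ :=
    fun b hb => endpoints_mem_cellSupp (h₁' (mem_of_couplingOn_ne_zero hb))
  have hc₂ : ∀ b, couplingOn τ K₂' b ≠ 0 → b.1 ∈ cellSupp Bond.verts K₂ ∧ b.2.1 ∈ cellSupp Bond.verts K₂ :=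
    fun b hb => endpoints_mem_cellSupp (h₂' (mem_of_couplingOn_ne_zero hb))
  rw [union_sdiff_union_eq hK h₁' h₂', Finset.card_union_of_disjoint hsd, pow_add, couplingOn_union τ hK',
    gibbsRatio_add hz h hc₁ hc₂]
  ring

end Weights

/-! ### The polymer representation in a finite volume -/

section Representation

variable {Λ : Type*} [LinearOrder Λ] [Fintype Λ] (G : SimpleGraph Λ) [DecidableRel G.Adj]

/-- The bonds of the graph `G`: ordered adjacent pairs with a spin. [cite: Ueltschi1999, §3 (bonds 𝐀 = (⟨x,y⟩,σ))] -/
def hubbardBonds : Finset (Bond Λ) := Finset.univ.filter fun b => G.Adj b.1 b.2.1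

omit [LinearOrder Λ] in
/-- Membership in `hubbardBonds`. [folklore] -/
@[simp] theorem mem_hubbardBonds {b : Bond Λ} : b ∈ hubbardBonds G ↔ G.Adj b.1 b.2.1 := by
  simp [hubbardBonds]

/-- The couplings `τ` on the bonds of `G` are the Hubbard couplings. [cite: Ueltschi1999, §3] -/
theorem couplingOn_hubbardBonds (τ : ℂ) : couplingOn τ (hubbardBonds G) = hubbardCoupling G τ := by
  funext b
  simp only [couplingOn_apply, hubbardCoupling_apply, mem_hubbardBonds]

/-- **The site activity** of the Hubbard polymer expansion in the volume `Λ`: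
`ρ(A) = Σ_{X ⊆ bonds(G) connected, supp X = A} M(X)` (connected = chained by shared sites), for
`A : Finset Λ`. [cite: Ueltschi1999, §2.3 (weights ρ(𝒜) of the polymers) and §3 ("our polymers are now connected sets")] -/
def siteActivity (β U μ τ : ℂ) : Finset Λ → ℂ :=
  pushforwardActivity (cellSupp Bond.verts) (bondWeight β U μ τ) (connectedCellSets Bond.verts (hubbardBonds G))

variable {G}

/-- The site activity unfolded. [folklore] -/
theorem siteActivity_apply (β U μ τ : ℂ) (A : Finset Λ) :
    siteActivity G β U μ τ A =
      ∑ X ∈ (connectedCellSets Bond.verts (hubbardBonds G)).filter (fun X => cellSupp Bond.verts X = A),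
        bondWeight β U μ τ X := rfl

variable {β U μ : ℂ}

/-- **The polymer representation of the Gibbs factor**:
`Zc(βt · 1_{bonds G}) = z₀^{|Λ|} · Ξ^{polyInc}_{𝒫(Λ)}(siteActivity)` (`z₀ ≠ 0`).
[cite: Ueltschi1999, §2.3 (Tr e^{-βH_Λ} = e^{-βf₀|Λ|} Σ_{𝒜₁,…,𝒜_ℓ disjoint} Π ρ(𝒜_j))] -/
theorem Zc_hubbardCoupling_eq_mul_polymerPartitionFunction (hz : atomicPartitionFn β U μ ≠ 0) (τ : ℂ) :
    Zc β U μ (hubbardCoupling G τ) =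
      atomicPartitionFn β U μ ^ Fintype.card Λ *
        polymerPartitionFunction polyInc (siteActivity G β U μ τ) (Finset.univ : Finset Λ).powerset := by
  have h0 : Zc β U μ (0 : Bond Λ → ℂ) ≠ 0 := Zc_zero_ne_zero hz
  -- normalise
  have h1 : Zc β U μ (hubbardCoupling G τ) = Zc β U μ (0 : Bond Λ → ℂ) * gibbsRatio β U μ (couplingOn τ (hubbardBonds G)) := by
    rw [gibbsRatio, couplingOn_hubbardBonds, mul_div_cancel₀ _ h0]
  -- Möbius inversion over the bond sets
  have h2 : gibbsRatio β U μ (couplingOn τ (hubbardBonds G)) =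
      ∑ K ∈ (hubbardBonds G).powerset, bondWeight β U μ τ K := by
    simp_rw [bondWeight_eq_sum]
    exact (sum_powerset_sum_powerset_neg_one_pow_card_sdiff_mul (M := ℂ)
      (fun K => gibbsRatio β U μ (couplingOn τ K)) (hubbardBonds G)).symm
  -- components and pushforward to site polymers
  have h3 := sum_powerset_eq_polymerPartitionFunction_cellSupp (verts := (Bond.verts : Bond Λ → Finset Λ))
    verts_nonempty (bondWeight β U μ τ) (bondWeight_empty hz τ) (fun K₁ K₂ h => bondWeight_union hz τ h)
    (hubbardBonds G)
  -- enlarge the volume to all subsets (the new polymers have zero activity)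
  have h4 : polymerPartitionFunction polyInc (siteActivity G β U μ τ) (Finset.univ : Finset Λ).powerset =
      polymerPartitionFunction polyInc (siteActivity G β U μ τ)
        ((connectedCellSets Bond.verts (hubbardBonds G)).image (cellSupp Bond.verts)) :=
    polymerPartitionFunction_eq_of_subset_of_eq_zero (fun A _ => Finset.mem_powerset.2 (Finset.subset_univ _))
      fun A _ hA => pushforwardActivity_eq_zero_of_not_mem_image hA
  rw [h1, h2, h3, Zc_zero, h4, siteActivity]

/-- **The polymer representation of the Hubbard partition function** (real parameters):
`Tr e^{-β(H(t,U) - μN)} = z₀^{|Λ|} · Ξ^{polyInc}_{𝒫(Λ)}(siteActivity G β U μ (βt))`.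
[cite: Ueltschi1999, §2.3 (polymer form of Tr e^{-βH_Λ}) and §3] -/
theorem partitionFn_eq_mul_polymerPartitionFunction (β t U μ : ℝ) :
    Matrix.partitionFn β (hamiltonianWith G t U μ) =
      atomicPartitionFn β U μ ^ Fintype.card Λ *
        polymerPartitionFunction polyInc (siteActivity G (β : ℂ) (U : ℂ) (μ : ℂ) ((β : ℂ) * (t : ℂ)))
          (Finset.univ : Finset Λ).powerset := by
  have hz : atomicPartitionFn (β : ℂ) (U : ℂ) (μ : ℂ) ≠ 0 := by
    rw [atomicPartitionFn_ofReal]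
    exact_mod_cast (atomicPartitionFnReal_pos β U μ).ne'
  rw [partitionFn_hamiltonianWith_eq_Zc, Zc_hubbardCoupling_eq_mul_polymerPartitionFunction hz]

/-! ### Support properties of the site activity -/

/-- The site activity of `A` vanishes unless `A` is the support of a connected set of bonds of
`G`. [folklore] -/
theorem siteActivity_eq_zero (τ : ℂ) {A : Finset Λ}
    (hA : ∀ X ⊆ hubbardBonds G, IsRConnected (ShareVertex Bond.verts) X → cellSupp Bond.verts X ≠ A) :
    siteActivity G β U μ τ A = 0 :=
  pushforwardActivity_cellSupp_eq_zero hA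

/-- The support of a connected set of bonds of `G` is `G`-connected. [folklore] -/
theorem isRConnected_adj_cellSupp {X : Finset (Bond Λ)} (hXG : X ⊆ hubbardBonds G)
    (hX : IsRConnected (ShareVertex Bond.verts) X) : IsRConnected G.Adj (cellSupp Bond.verts X) := by
  classical
  set S := cellSupp Bond.verts X with hS
  -- the two endpoints of a bond of `X` are joined inside `S`
  have hbond : ∀ b ∈ X, ∀ u ∈ Bond.verts b, ∀ v ∈ Bond.verts b,
      Relation.ReflTransGen (fun x y => G.Adj x y ∧ x ∈ S ∧ y ∈ S) u v := by
    intro b hb u hu v hv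
    have hadj : G.Adj b.1 b.2.1 := (mem_hubbardBonds (G := G)).1 (hXG hb)
    have h1 : b.1 ∈ S := (endpoints_mem_cellSupp hb).1
    have h2 : b.2.1 ∈ S := (endpoints_mem_cellSupp hb).2
    simp only [Bond.verts, Finset.mem_insert, Finset.mem_singleton] at hu hv
    rcases hu with rfl | rfl <;> rcases hv with rfl | rfl
    · exact Relation.ReflTransGen.refl
    · exact Relation.ReflTransGen.single ⟨hadj, h1, h2⟩
    · exact Relation.ReflTransGen.single ⟨hadj.symm, h2, h1⟩
    · exact Relation.ReflTransGen.refl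
  -- along a chain of bonds sharing vertices, any vertex of the first is joined to any vertex of the last
  have hchain : ∀ b b' : Bond Λ, Relation.ReflTransGen (fun c d => ShareVertex Bond.verts c d ∧ c ∈ X ∧ d ∈ X) b b' →
      b ∈ X → ∀ u ∈ Bond.verts b, ∀ v ∈ Bond.verts b',
        Relation.ReflTransGen (fun x y => G.Adj x y ∧ x ∈ S ∧ y ∈ S) u v := by
    intro b b' hbb' hb
    induction hbb' with
    | refl => exact fun u hu v hv => hbond b hb u hu v hv
    | @tail c d _ hcd ih =>
      intro u hu v hv
      obtain ⟨⟨w, hw⟩, hc, hd⟩ := hcd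
      obtain ⟨hwc, hwd⟩ := Finset.mem_inter.1 hw
      exact (ih u hu w hwc).trans (hbond d hd w hwd v hv)
  obtain ⟨hne, hconn⟩ := hX
  refine ⟨cellSupp_nonempty verts_nonempty hne, fun u hu v hv => ?_⟩
  obtain ⟨b, hb, hub⟩ := mem_cellSupp.1 hu
  obtain ⟨b', hb', hvb'⟩ := mem_cellSupp.1 hv
  exact hchain b b' (hconn b hb b' hb') hb u hub v hvb'

/-- **The site activity lives on `G`-connected site sets.** [cite: Ueltschi1999, §3 ("our polymers are now connected sets")] -/
theorem isRConnected_of_siteActivity_ne_zero {τ : ℂ} {A : Finset Λ} (hA : siteActivity G β U μ τ A ≠ 0) :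
    IsRConnected G.Adj A := by
  by_contra hcon
  refine hA (siteActivity_eq_zero τ fun X hXG hX hXA => hcon ?_)
  rw [← hXA]
  exact isRConnected_adj_cellSupp hXG hX

end Representation

/-! ### Covariance of the site activity under embeddings of induced subgraphs -/

section Transport

variable {Λ Λ' : Type*} [LinearOrder Λ] [Fintype Λ] [LinearOrder Λ'] [Fintype Λ'] (e : Λ ↪o Λ')
variable {G : SimpleGraph Λ} [DecidableRel G.Adj] {G' : SimpleGraph Λ'} [DecidableRel G'.Adj]

/-- The induced embedding of bonds. [folklore] -/
def bondEmb : Bond Λ ↪ Bond Λ' := ⟨bondMap e, bondMap_injective e⟩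

omit [Fintype Λ] [Fintype Λ'] in
/-- `bondEmb` unfolded. [folklore] -/
@[simp] theorem bondEmb_apply (b : Bond Λ) : bondEmb e b = bondMap e b := rfl

omit [Fintype Λ] [Fintype Λ'] in
/-- The vertex set of the image bond. [folklore] -/
theorem verts_bondMap (b : Bond Λ) : Bond.verts (bondMap e b) = (Bond.verts b).map e.toEmbedding := by
  simp [Bond.verts, bondMap, Finset.map_insert]

omit [Fintype Λ'] in
/-- The couplings of the image bond set are the extension by zero of the couplings. [folklore] -/
theorem couplingOn_map (τ : ℂ) (K : Finset (Bond Λ)) :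
    couplingOn τ (K.map (bondEmb e)) = Function.extend (bondMap e) (couplingOn τ K) 0 := by
  funext b'
  by_cases hb' : ∃ b, bondMap e b = b'
  · obtain ⟨b, rfl⟩ := hb'
    rw [(bondMap_injective e).extend_apply, couplingOn_apply, couplingOn_apply]
    have hiff : bondMap e b ∈ K.map (bondEmb e) ↔ b ∈ K := Finset.mem_map' (bondEmb e)
    by_cases hb : b ∈ K
    · rw [if_pos (hiff.2 hb), if_pos hb]
    · rw [if_neg (fun h => hb (hiff.1 h)), if_neg hb]
  · rw [Function.extend_apply' _ _ _ hb', Pi.zero_apply, couplingOn_apply, if_neg]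
    intro h
    obtain ⟨b, -, hb⟩ := Finset.mem_map.1 h
    exact hb' ⟨b, hb⟩

variable {β U μ : ℂ}

/-- The normalised Gibbs factor is invariant under extension by zero along `e`. [cite: Ueltschi1999, §2.3 (ρ(𝒜) only involves the sites of 𝒜)] -/
theorem gibbsRatio_extend (hz : atomicPartitionFn β U μ ≠ 0) (c : Bond Λ → ℂ) :
    gibbsRatio (Λ := Λ') β U μ (Function.extend (bondMap e) c 0) = gibbsRatio β U μ c := by
  have hext0 : Function.extend (bondMap e) (0 : Bond Λ → ℂ) 0 = (0 : Bond Λ' → ℂ) := by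
    funext b'
    by_cases h : ∃ b, bondMap e b = b'
    · obtain ⟨b, rfl⟩ := h
      rw [(bondMap_injective e).extend_apply]; rfl
    · rw [Function.extend_apply' _ _ _ h]
  have hk : atomicPartitionFn β U μ ^ (Fintype.card Λ' - Fintype.card Λ) ≠ 0 := pow_ne_zero _ hz
  have h0 : Zc β U μ (0 : Bond Λ' → ℂ) =
      Zc β U μ (0 : Bond Λ → ℂ) * atomicPartitionFn β U μ ^ (Fintype.card Λ' - Fintype.card Λ) := by
    rw [← Zc_extend e β U μ (0 : Bond Λ → ℂ), hext0]
  unfold gibbsRatio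
  rw [Zc_extend, h0, mul_div_mul_right _ _ hk]

/-- **The bond weights are invariant under the embedding.** [cite: Ueltschi1999, §2.3 (ρ(𝒜) only involves the sites of 𝒜)] -/
theorem bondWeight_map (hz : atomicPartitionFn β U μ ≠ 0) (τ : ℂ) (K : Finset (Bond Λ)) :
    bondWeight (Λ := Λ') β U μ τ (K.map (bondEmb e)) = bondWeight β U μ τ K := by
  rw [bondWeight_eq_sum, bondWeight_eq_sum]
  symm
  refine Finset.sum_bij (fun K' _ => K'.map (bondEmb e)) ?_ ?_ ?_ ?_
  · intro K' hK'
    exact Finset.mem_powerset.2 (Finset.map_subset_map.2 (Finset.mem_powerset.1 hK'))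
  · intro K₁ _ K₂ _ h
    exact Finset.map_injective _ h
  · intro K'' hK''
    obtain ⟨u, hu, rfl⟩ := Finset.subset_map_iff.1 (Finset.mem_powerset.1 hK'')
    exact ⟨u, Finset.mem_powerset.2 hu, rfl⟩
  · intro K' _
    rw [couplingOn_map, gibbsRatio_extend e hz, ← Finset.map_sdiff, Finset.card_map]

/-- Bonds of `G` map to bonds of `G'` when `e` embeds `G` as an induced subgraph. [folklore] -/
theorem map_hubbardBonds_subset (hG : ∀ x y, G'.Adj (e x) (e y) ↔ G.Adj x y) :
    (hubbardBonds G).map (bondEmb e) ⊆ hubbardBonds G' := by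
  intro b' hb'
  obtain ⟨b, hb, rfl⟩ := Finset.mem_map.1 hb'
  rw [mem_hubbardBonds] at hb ⊢
  exact (hG _ _).2 hb

/-- A set of bonds of `G'` supported inside the image of `A` is the image of a set of bonds of
`G`. [folklore] -/
theorem exists_map_eq_of_cellSupp_eq (hG : ∀ x y, G'.Adj (e x) (e y) ↔ G.Adj x y) (A : Finset Λ)
    {X' : Finset (Bond Λ')} (hX' : X' ⊆ hubbardBonds G') (hsupp : cellSupp Bond.verts X' = A.map e.toEmbedding) :
    ∃ X ⊆ hubbardBonds G, X.map (bondEmb e) = X' := by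
  classical
  -- every bond of `X'` is an image bond
  have himg : ∀ b' ∈ X', ∃ b : Bond Λ, bondMap e b = b' := by
    intro b' hb'
    have h1 : b'.1 ∈ A.map e.toEmbedding := hsupp ▸ (endpoints_mem_cellSupp hb').1
    have h2 : b'.2.1 ∈ A.map e.toEmbedding := hsupp ▸ (endpoints_mem_cellSupp hb').2
    obtain ⟨x, -, hx⟩ := Finset.mem_map.1 h1
    obtain ⟨y, -, hy⟩ := Finset.mem_map.1 h2
    refine ⟨(x, y, b'.2.2), ?_⟩
    simp only [bondMap]
    rw [RelEmbedding.coe_toEmbedding] at hx hy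
    rw [hx, hy]
  refine ⟨X'.preimage (bondMap e) (bondMap_injective e).injOn, fun b hb => ?_, ?_⟩
  · rw [Finset.mem_preimage] at hb
    have := (mem_hubbardBonds (G := G')).1 (hX' hb)
    exact (mem_hubbardBonds (G := G)).2 ((hG _ _).1 this)
  · ext b'
    simp only [Finset.mem_map, Finset.mem_preimage, bondEmb_apply]
    constructor
    · rintro ⟨b, hb, rfl⟩; exact hb
    · intro hb'
      obtain ⟨b, rfl⟩ := himg b' hb'
      exact ⟨b, hb', rfl⟩

/-- **Covariance of the site activity**: if `e : Λ ↪o Λ'` embeds `G` as an induced subgraph of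
`G'`, then `siteActivity G' (e A) = siteActivity G A` for every `A ⊆ Λ` (`z₀ ≠ 0`). In particular
the Hubbard polymer weights on `ℤ^d` are translation invariant and do not depend on the box in
which they are computed. [cite: Ueltschi1999, §2.3 (ρ(𝒜) only involves the sites of 𝒜; periodic weights)] -/
theorem siteActivity_map (hz : atomicPartitionFn β U μ ≠ 0) (hG : ∀ x y, G'.Adj (e x) (e y) ↔ G.Adj x y)
    (τ : ℂ) (A : Finset Λ) :
    siteActivity G' β U μ τ (A.map e.toEmbedding) = siteActivity G β U μ τ A :=
  pushforwardActivity_connectedCellSets_map (verts := (Bond.verts : Bond Λ → Finset Λ))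
    (verts' := (Bond.verts : Bond Λ' → Finset Λ')) (f := bondEmb e) (φ := e.toEmbedding)
    (verts_bondMap e) A (map_hubbardBonds_subset e hG)
    (fun _ hX' _ hsupp => exists_map_eq_of_cellSupp_eq e hG A hX' hsupp)
    (fun X _ => bondWeight_map e hz τ X)

end Transport

end Literature.MathematicalPhysics.QuantumLattice

end
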